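import Summits.ResolutionOfSingularities.ResolutionOfSingularities.Theorems.FrobeniusLadderFInjectiveMacaulayficationNewtonChartLemma
import HarnessLib

/-!
# Transversality of the strict transform of a Fermat-type hypersurface and of a pulled-back binomial along a torus orbit
# (BED Ω₁ GLOBAL PATCH, F6 v2 §3 «BP–binomial transversality»: at the T1 points of the pencil `(ȳ^{M₁}, ȳ^r − ȳ^s)` on a chart `V(θ_c)` of `X̃₂` some `2 × 2` minor of `∂(θ_c, w)/∂y` over the
# non-orbit letters is nonzero, unless the common face is the one face where the binomial's exponent difference is balanced;
# crux `FInjectiveMacaulayfication` stmt-ResolutionOfSingularities-15315, chain w45a; seat res-L1-w45a-stub-3 g15)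

[OURS · L1 W4.5a] Support file (`--supports stmt-ResolutionOfSingularities-15315 --as helper`); theorems only; unconditional; no named fact; NOT a statement of any manuscript; nothing of
the crux is proved. AI-written (AI review is weaker than expert review).

SETTING (any field `k`). `f = Σ_j X_j^{n_j}` (`n_j ≠ 0` in `k`), `g = X^P − X^Q`; a unimodular exponent matrix `V`; on the chart the strict transform of `f` is `θ = Σ_j Y^{a_j}` with
`a_j + d = V·(n_j e_j)`, and `g` pulls back to `Y^m·w`, `w = Y^r − Y^s`, `r + m = V·P`, `s + m = V·Q`. A point `y` of the orbit `{y_i = 0 ⟺ i ∈ S}` with `θ(y) = w(y) = 0`, both monomials of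
`w` free of the letters of `S` («T1»), some `i ∉ S` with `r_i ≠ s_i` in `k`, and some `l ∉ S` with `∂θ/∂y_l(y) ≠ 0` (Ishii's Lemma 4.4.24, supplied by the caller).
* ★★ `face_iff_of_minors_eq_zero` — IF every minor `∂_iθ·∂_{i′}w − ∂_{i′}θ·∂_i w` (`i, i′ ∉ S`) vanishes at `y`, THEN for every `j`: the monomial `Y^{a_j}` is free of the `S`-letters iff
  `P_j ≠ Q_j` in `k` (log-derivatives along the orbit, `θ(y) = 0`, and `det V = ±1` force `Σ_j y^{a_j}·n_j e_j = κ·(P − Q)` in `kᵐ`);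
* `eval_pderiv_w_ne_zero_of_minors_eq_zero` — in that case `∂w/∂y_l(y) ≠ 0` for the Ishii letter `l`;
* ★★ `exists_minor_ne_zero` — contrapositive: a nonzero minor over two non-orbit letters whenever the face test fails; ★ `b9_exists_minor_ne_zero` — the specimen `f = X₄² + Σ_{i<4} X_i⁹`,
  `g = X₀X₂² − X₁³`, `2·3 ≠ 0` in `k`: a nonzero minor unless exactly `Y^{a₀}, Y^{a₁}, Y^{a₂}` are the `S`-free monomials of `θ`.
[cite: IshiiSingularities2018, Lemma 4.4.24 (pp. 96–97)]
-/

set_option linter.dupNamespace false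

noncomputable section

namespace Summit.ResolutionOfSingularities.ResolutionOfSingularities.Theorems.FInjectiveMacaulayfication.BPBinomialTransversal

open MvPolynomial
open Summit.ResolutionOfSingularities.ResolutionOfSingularities.Theorems.FInjectiveMacaulayfication NewtonChartLemma

variable {k : Type} [Field k] {m : ℕ}

/-! ## §1 Evaluation bookkeeping on the orbit -/

/-- A monomial is nonzero at `y` iff it is free of the letters vanishing at `y`. [plumbing] -/
theorem eval_monomial_ne_zero_iff (S : Finset (Fin m)) (y : Fin m → k) (hy : ∀ i, y i = 0 ↔ i ∈ S) (β : Fin m →₀ ℕ) :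
    MvPolynomial.eval y (monomial β (1 : k)) ≠ 0 ↔ ∀ i ∈ S, β i = 0 := by
  constructor
  · intro h i hi
    by_contra hβ
    exact h (eval_monomial_eq_zero_of_exists S y hy β 1 ⟨i, hi, hβ⟩)
  · intro h
    rw [eval_monomial_eq_of_forall S y β 1 h, one_mul]
    exact Finset.prod_ne_zero_iff.mpr fun i hi => pow_ne_zero _ fun h0 => (Finset.mem_compl.mp hi) ((hy i).mp h0)

/-- `y_i · ∂_i(Σ_j Y^{a_j})(y) = Σ_j (a_j)_i · Y^{a_j}(y)`. [folklore] -/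
theorem mul_eval_pderiv_sum (y : Fin m → k) (i : Fin m) (a : Fin m → (Fin m →₀ ℕ)) :
    y i * MvPolynomial.eval y (pderiv i (∑ j : Fin m, monomial (a j) (1 : k))) = ∑ j : Fin m, ((a j i : ℕ) : k) * MvPolynomial.eval y (monomial (a j) (1 : k)) := by
  rw [map_sum, map_sum, Finset.mul_sum]
  exact Finset.sum_congr rfl fun j _ => mul_eval_pderiv_monomial y i (a j) 1

/-- On the orbit, `Σ_j (a_j)_i · Y^{a_j}(y) = 0` for `i ∈ S` (each term has `(a_j)_i = 0` or `Y^{a_j}(y) = 0`). [plumbing] -/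
theorem sum_exponent_mul_eval_eq_zero_of_mem (S : Finset (Fin m)) (y : Fin m → k) (hy : ∀ i, y i = 0 ↔ i ∈ S) (a : Fin m → (Fin m →₀ ℕ))
    (i : Fin m) (hi : i ∈ S) : ∑ j : Fin m, ((a j i : ℕ) : k) * MvPolynomial.eval y (monomial (a j) (1 : k)) = 0 := by
  refine Finset.sum_eq_zero fun j _ => ?_
  by_cases h : a j i = 0
  · rw [h, Nat.cast_zero, zero_mul]
  · rw [eval_monomial_eq_zero_of_exists S y hy (a j) 1 ⟨i, hi, h⟩, mul_zero]

/-- `y_i · ∂_i(Y^r − Y^s)(y) = r_i·Y^r(y) − s_i·Y^s(y)`. [folklore] -/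
theorem mul_eval_pderiv_binomial (y : Fin m → k) (i : Fin m) (r s : Fin m →₀ ℕ) :
    y i * MvPolynomial.eval y (pderiv i (monomial r (1 : k) - monomial s 1)) =
      (r i : k) * MvPolynomial.eval y (monomial r (1 : k)) - (s i : k) * MvPolynomial.eval y (monomial s (1 : k)) := by
  rw [map_sub, map_sub, mul_sub, mul_eval_pderiv_monomial, mul_eval_pderiv_monomial]

/-! ## §2 ★★ The face alternative -/

section Face

variable (V : Matrix (Fin m) (Fin m) ℕ) (hV : IsUnit (V.map (Nat.cast : ℕ → ℤ)).det)
  (n : Fin m → ℕ) (d : Fin m → ℕ) (a : Fin m → (Fin m →₀ ℕ)) (ha : ∀ j i, a j i + d i = V i j * n j)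
  (P Q : Fin m → ℕ) (mm r s : Fin m →₀ ℕ) (hr : ∀ i, r i + mm i = ∑ j, V i j * P j) (hs : ∀ i, s i + mm i = ∑ j, V i j * Q j)
  (S : Finset (Fin m)) (y : Fin m → k) (hy : ∀ i, y i = 0 ↔ i ∈ S)
  (hrS : ∀ i ∈ S, r i = 0) (hsS : ∀ i ∈ S, s i = 0)
  (hθy : MvPolynomial.eval y (∑ j : Fin m, monomial (a j) (1 : k)) = 0)
  (hwy : MvPolynomial.eval y (monomial r (1 : k) - monomial s 1) = 0)

include hy hrS hwy in
/-- On the orbit, `Y^r(y) = Y^s(y) ≠ 0`. [plumbing] -/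
theorem eval_r_eq_eval_s_and_ne_zero :
    MvPolynomial.eval y (monomial s (1 : k)) = MvPolynomial.eval y (monomial r (1 : k)) ∧ MvPolynomial.eval y (monomial r (1 : k)) ≠ 0 := by
  rw [map_sub, sub_eq_zero] at hwy
  exact ⟨hwy.symm, (eval_monomial_ne_zero_iff S y hy r).mpr hrS⟩

include hy hrS hwy in
/-- If all minors over two non-orbit letters vanish and `∂θ/∂y_l(y) ≠ 0` (`l ∉ S`) while some `r_i ≠ s_i` in `k` off `S`, then `∂w/∂y_l(y) ≠ 0`. [OURS · route (β)] -/
theorem eval_pderiv_w_ne_zero_of_minors_eq_zero (θ : MvPolynomial (Fin m) k)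
    (hmin : ∀ i i', i ∉ S → i' ∉ S →
      MvPolynomial.eval y (pderiv i θ) * MvPolynomial.eval y (pderiv i' (monomial r (1 : k) - monomial s 1)) -
        MvPolynomial.eval y (pderiv i' θ) * MvPolynomial.eval y (pderiv i (monomial r (1 : k) - monomial s 1)) = 0)
    (hnp : ∃ i, i ∉ S ∧ (r i : k) ≠ (s i : k)) (l : Fin m) (hl : l ∉ S) (hθl : MvPolynomial.eval y (pderiv l θ) ≠ 0) :
    MvPolynomial.eval y (pderiv l (monomial r (1 : k) - monomial s 1)) ≠ 0 := by
  intro hwl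
  obtain ⟨i, hi, hne⟩ := hnp
  obtain ⟨hsr, hν⟩ := eval_r_eq_eval_s_and_ne_zero r s S y hy hrS hwy
  -- `∂_i w(y) = 0` from the minor with `l`
  have h := hmin l i hl hi
  rw [hwl, mul_zero, sub_zero] at h
  have hwi : MvPolynomial.eval y (pderiv i (monomial r (1 : k) - monomial s 1)) = 0 := (mul_eq_zero.mp h).resolve_left hθl
  -- `(r_i − s_i)·Y^r(y) = 0`
  have h2 := mul_eval_pderiv_binomial y i r s
  rw [hwi, mul_zero, hsr] at h2
  have h3 : ((r i : k) - (s i : k)) * MvPolynomial.eval y (monomial r (1 : k)) = 0 := by rw [sub_mul, ← h2]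
  rcases mul_eq_zero.mp h3 with h4 | h4
  · exact hne (sub_eq_zero.mp h4)
  · exact hν h4

include hV ha hr hs hy hrS hsS hθy hwy in
/-- ★★ **THE FACE ALTERNATIVE.** If every minor over two non-orbit letters vanishes at `y`, then `Y^{a_j}` is free of the `S`-letters iff `P_j ≠ Q_j` in `k`, for every `j`.
[cite: IshiiSingularities2018, Lemma 4.4.24 (method)] -/
theorem face_iff_of_minors_eq_zero (hn : ∀ j, (n j : k) ≠ 0)
    (hmin : ∀ i i', i ∉ S → i' ∉ S →
      MvPolynomial.eval y (pderiv i (∑ j : Fin m, monomial (a j) (1 : k))) * MvPolynomial.eval y (pderiv i' (monomial r (1 : k) - monomial s 1)) -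
        MvPolynomial.eval y (pderiv i' (∑ j : Fin m, monomial (a j) (1 : k))) * MvPolynomial.eval y (pderiv i (monomial r (1 : k) - monomial s 1)) = 0)
    (hnp : ∃ i, i ∉ S ∧ (r i : k) ≠ (s i : k)) (hl : ∃ l, l ∉ S ∧ MvPolynomial.eval y (pderiv l (∑ j : Fin m, monomial (a j) (1 : k))) ≠ 0) :
    ∀ j, (∀ i ∈ S, a j i = 0) ↔ (P j : k) ≠ (Q j : k) := by
  classical
  obtain ⟨l, hlS, hθl⟩ := hl
  set θ : MvPolynomial (Fin m) k := ∑ j : Fin m, monomial (a j) (1 : k) with hθ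
  set μ : Fin m → k := fun j => MvPolynomial.eval y (monomial (a j) (1 : k)) with hμ
  obtain ⟨hsr, hν⟩ := eval_r_eq_eval_s_and_ne_zero r s S y hy hrS hwy
  set ν : k := MvPolynomial.eval y (monomial r (1 : k)) with hνdef
  have hwl : MvPolynomial.eval y (pderiv l (monomial r (1 : k) - monomial s 1)) ≠ 0 :=
    eval_pderiv_w_ne_zero_of_minors_eq_zero r s S y hy hrS hwy θ hmin hnp l hlS hθl
  -- the proportionality constants
  set lam : k := MvPolynomial.eval y (pderiv l (monomial r (1 : k) - monomial s 1)) / MvPolynomial.eval y (pderiv l θ) with hlam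
  have hlam0 : lam ≠ 0 := div_ne_zero hwl hθl
  set κ : k := ν / lam with hκ
  have hκ0 : κ ≠ 0 := div_ne_zero hν hlam0
  -- the key identity `Σ_j (a_j)_i μ_j = κ (r_i − s_i)` for every `i`
  have key : ∀ i : Fin m, ∑ j : Fin m, ((a j i : ℕ) : k) * μ j = κ * ((r i : k) - (s i : k)) := by
    intro i
    by_cases hi : i ∈ S
    · rw [sum_exponent_mul_eval_eq_zero_of_mem S y hy a i hi, hrS i hi, hsS i hi, sub_self, mul_zero]
    · -- `∂_i w = lam ∂_i θ`
      have hprop : MvPolynomial.eval y (pderiv i (monomial r (1 : k) - monomial s 1)) = lam * MvPolynomial.eval y (pderiv i θ) := by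
        have h := hmin l i hlS hi
        rw [hlam, div_mul_eq_mul_div, eq_div_iff hθl]
        linear_combination h
      have h1 := mul_eval_pderiv_sum y i a
      have h2 := mul_eval_pderiv_binomial y i r s
      rw [hsr, hprop] at h2
      -- `(r_i − s_i) ν = lam · Σ_j (a_j)_i μ_j`
      have h3 : ((r i : k) - (s i : k)) * ν = lam * (∑ j : Fin m, ((a j i : ℕ) : k) * μ j) := by
        rw [← h1]; linear_combination (-1 : k) * h2
      rw [hκ, div_mul_eq_mul_div, eq_div_iff hlam0]
      linear_combination (-1 : k) * h3
  -- `V · u = 0` for `u_j = μ_j n_j − κ (P_j − Q_j)`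
  have hθsum : ∑ j : Fin m, μ j = 0 := by
    have := hθy
    rw [map_sum] at this
    exact this
  have hVu : (V.map (Nat.cast : ℕ → k)).mulVec (fun j => μ j * (n j : k) - κ * ((P j : k) - (Q j : k))) = 0 := by
    ext i
    rw [Matrix.mulVec, dotProduct, Pi.zero_apply]
    simp only [Matrix.map_apply]
    have hsplit : ∑ j : Fin m, (V i j : k) * (μ j * (n j : k) - κ * ((P j : k) - (Q j : k))) =
        (∑ j : Fin m, ((a j i : ℕ) : k) * μ j) + (d i : k) * (∑ j : Fin m, μ j) -
          κ * ((∑ j : Fin m, (V i j : k) * (P j : k)) - (∑ j : Fin m, (V i j : k) * (Q j : k))) := by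
      rw [mul_sub, Finset.mul_sum, Finset.mul_sum, Finset.mul_sum, ← Finset.sum_sub_distrib, ← Finset.sum_add_distrib, ← Finset.sum_sub_distrib]
      refine Finset.sum_congr rfl fun j _ => ?_
      have haj : ((a j i : ℕ) : k) + (d i : k) = (V i j : k) * (n j : k) := by
        have := congrArg (Nat.cast : ℕ → k) (ha j i); push_cast at this; exact this
      linear_combination (-(μ j)) * haj
    have hrP : (∑ j : Fin m, (V i j : k) * (P j : k)) = (r i : k) + (mm i : k) := by
      have := congrArg (Nat.cast : ℕ → k) (hr i); push_cast at this; exact this.symm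
    have hsQ : (∑ j : Fin m, (V i j : k) * (Q j : k)) = (s i : k) + (mm i : k) := by
      have := congrArg (Nat.cast : ℕ → k) (hs i); push_cast at this; exact this.symm
    rw [hsplit, hθsum, mul_zero, add_zero, hrP, hsQ, key i]
    ring
  have hu := Matrix.eq_zero_of_mulVec_eq_zero (det_cast_ne_zero (k := k) V hV) hVu
  -- read off coordinate `j`
  intro j
  have hj := congr_fun hu j
  rw [Pi.zero_apply, sub_eq_zero] at hj
  -- `μ_j n_j = κ (P_j − Q_j)`
  rw [← eval_monomial_ne_zero_iff S y hy (a j)]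
  change μ j ≠ 0 ↔ _
  constructor
  · intro hμ hPQ
    rw [hPQ, sub_self, mul_zero] at hj
    exact (mul_ne_zero hμ (hn j)) hj
  · intro hPQ hμ
    rw [hμ, zero_mul] at hj
    exact (mul_ne_zero hκ0 (sub_ne_zero.mpr hPQ)) hj.symm

include hV ha hr hs hy hrS hsS hθy hwy in
/-- ★★ **A NONZERO MINOR OVER TWO NON-ORBIT LETTERS WHENEVER THE FACE TEST FAILS.** [cite: IshiiSingularities2018, Lemma 4.4.24 (method)] -/
theorem exists_minor_ne_zero (hn : ∀ j, (n j : k) ≠ 0) (hnp : ∃ i, i ∉ S ∧ (r i : k) ≠ (s i : k))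
    (hl : ∃ l, l ∉ S ∧ MvPolynomial.eval y (pderiv l (∑ j : Fin m, monomial (a j) (1 : k))) ≠ 0)
    (hface : ¬ ∀ j, (∀ i ∈ S, a j i = 0) ↔ (P j : k) ≠ (Q j : k)) :
    ∃ i i', i ∉ S ∧ i' ∉ S ∧ i ≠ i' ∧ MvPolynomial.eval y (pderiv i (∑ j : Fin m, monomial (a j) (1 : k))) ≠ 0 ∧
      MvPolynomial.eval y (pderiv i (∑ j : Fin m, monomial (a j) (1 : k))) * MvPolynomial.eval y (pderiv i' (monomial r (1 : k) - monomial s 1)) -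
        MvPolynomial.eval y (pderiv i' (∑ j : Fin m, monomial (a j) (1 : k))) * MvPolynomial.eval y (pderiv i (monomial r (1 : k) - monomial s 1)) ≠ 0 := by
  by_contra hcon
  push Not at hcon
  apply hface
  refine face_iff_of_minors_eq_zero V hV n d a ha P Q mm r s hr hs S y hy hrS hsS hθy hwy hn (fun i i' hi hi' => ?_) hnp hl
  by_cases hθi : MvPolynomial.eval y (pderiv i (∑ j : Fin m, monomial (a j) (1 : k))) = 0
  · by_cases hθi' : MvPolynomial.eval y (pderiv i' (∑ j : Fin m, monomial (a j) (1 : k))) = 0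
    · rw [hθi, hθi', zero_mul, zero_mul, sub_zero]
    · rcases eq_or_ne i' i with h | h
      · subst h; ring
      · have := hcon i' i hi' hi h hθi'
        linear_combination (-1 : k) * this
  · rcases eq_or_ne i i' with h | h
    · subst h; ring
    · exact hcon i i' hi hi' h hθi

end Face

/-! ## §3 ★ The B9 specimen: `f = X₄² + Σ_{i<4} X_i⁹`, `g = X₀X₂² − X₁³` -/

/-- ★ **B9 / `X₀X₂² − X₁³`, `2·3 ≠ 0` in `k`**: at a T1 point of an orbit over which the face test of the pencil would single out exactly the monomials `Y^{a₀}, Y^{a₁}, Y^{a₂}` — and only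
then — can all minors vanish; otherwise some minor over two non-orbit letters is nonzero (with the row `∂θ` nonzero at its first letter). [OURS · F6 v2 §3] -/
theorem b9_exists_minor_ne_zero (h2 : (2 : k) ≠ 0) (h3 : (3 : k) ≠ 0) (V : Matrix (Fin 5) (Fin 5) ℕ) (hV : IsUnit (V.map (Nat.cast : ℕ → ℤ)).det)
    (d : Fin 5 → ℕ) (a : Fin 5 → (Fin 5 →₀ ℕ)) (ha : ∀ j i, a j i + d i = V i j * (![9, 9, 9, 9, 2] : Fin 5 → ℕ) j)
    (mm r s : Fin 5 →₀ ℕ) (hr : ∀ i, r i + mm i = ∑ j, V i j * (![1, 0, 2, 0, 0] : Fin 5 → ℕ) j) (hs : ∀ i, s i + mm i = ∑ j, V i j * (![0, 3, 0, 0, 0] : Fin 5 → ℕ) j)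
    (S : Finset (Fin 5)) (y : Fin 5 → k) (hy : ∀ i, y i = 0 ↔ i ∈ S) (hrS : ∀ i ∈ S, r i = 0) (hsS : ∀ i ∈ S, s i = 0)
    (hθy : MvPolynomial.eval y (∑ j : Fin 5, monomial (a j) (1 : k)) = 0) (hwy : MvPolynomial.eval y (monomial r (1 : k) - monomial s 1) = 0)
    (hnp : ∃ i, i ∉ S ∧ (r i : k) ≠ (s i : k)) (hl : ∃ l, l ∉ S ∧ MvPolynomial.eval y (pderiv l (∑ j : Fin 5, monomial (a j) (1 : k))) ≠ 0)
    (hface : ¬ ((∀ i ∈ S, a 0 i = 0) ∧ (∀ i ∈ S, a 1 i = 0) ∧ (∀ i ∈ S, a 2 i = 0) ∧ ¬ (∀ i ∈ S, a 3 i = 0) ∧ ¬ (∀ i ∈ S, a 4 i = 0))) :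
    ∃ i i', i ∉ S ∧ i' ∉ S ∧ i ≠ i' ∧ MvPolynomial.eval y (pderiv i (∑ j : Fin 5, monomial (a j) (1 : k))) ≠ 0 ∧
      MvPolynomial.eval y (pderiv i (∑ j : Fin 5, monomial (a j) (1 : k))) * MvPolynomial.eval y (pderiv i' (monomial r (1 : k) - monomial s 1)) -
        MvPolynomial.eval y (pderiv i' (∑ j : Fin 5, monomial (a j) (1 : k))) * MvPolynomial.eval y (pderiv i (monomial r (1 : k) - monomial s 1)) ≠ 0 := by
  have h9 : ((9 : ℕ) : k) ≠ 0 := by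
    have : ((9 : ℕ) : k) = 3 * 3 := by norm_num
    rw [this]; exact mul_ne_zero h3 h3
  have h2' : ((2 : ℕ) : k) ≠ 0 := by exact_mod_cast h2
  refine exists_minor_ne_zero V hV ![9, 9, 9, 9, 2] d a ha ![1, 0, 2, 0, 0] ![0, 3, 0, 0, 0] mm r s hr hs S y hy hrS hsS hθy hwy (fun j => ?_) hnp hl (fun hall => hface ?_)
  · match j with
    | 0 => exact h9
    | 1 => exact h9
    | 2 => exact h9
    | 3 => exact h9
    | 4 => exact h2'
  · have h0 := hall 0
    have h1 := hall 1
    have h22 := hall 2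
    have h33 := hall 3
    have h44 := hall 4
    refine ⟨h0.mpr ?_, h1.mpr ?_, h22.mpr ?_, fun h => (h33.mp h) rfl, fun h => (h44.mp h) rfl⟩
    · show ((1 : ℕ) : k) ≠ ((0 : ℕ) : k)
      rw [Nat.cast_one, Nat.cast_zero]; exact one_ne_zero
    · show ((0 : ℕ) : k) ≠ ((3 : ℕ) : k)
      rw [Nat.cast_zero, Nat.cast_ofNat]; exact h3.symm
    · show ((2 : ℕ) : k) ≠ ((0 : ℕ) : k)
      rw [Nat.cast_zero, Nat.cast_ofNat]; exact h2

end Summit.ResolutionOfSingularities.ResolutionOfSingularities.Theorems.FInjectiveMacaulayfication.BPBinomialTransversal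

end
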